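import Summits.CriticalPhenomena.PercolationContinuityZ3.Theorems.Transplant.FKConnectivityAllQCountReweightedClusterDomDefs
import Summits.CriticalPhenomena.PercolationContinuityZ3.Theorems.PercNearOneGluingNoHeavyLowerTailFKExactEval
import Literature.Probability.Percolation.KozmaNitzanPreFKG
import HarnessLib

/-!
# Log-convexity cannot be dropped: MM FAILS for the increasing log-CONCAVE count weight `h(k) = k + 1` — a kernel certificate
# (`decide`, standard axioms) on a five-vertex tree, plus the exact-evaluation bridge for `crMeasure`

Support file (`--supports stmt-CriticalPhenomena-4575`), FK sub-lane `prim-bschramm-fk-1` (gen 10) of the post-continuity programme;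
builds on p205010 (kernel theorem, internal audit signed; external expert review pending).  No named facts, no sorries; standard axioms
(`decide +kernel`, no `native_decide`).

* EVALUATION BRIDGE for `μ_{w,h} = crMeasure w h ∝ P_w·h(k)` on a listed weighted graph `D : RCEval` (fk-3's exact evaluator): computable
  `mhQ hQ t = wQ t · hQ(kB t)`, `ZhQ`, `masshQ`; `crWeight_conf`, `sum_crWeight_mul`, `crPartition_eq_ZhQ`, **`cr_real_eq_masshQ_div`**
  (`μ_{w,h}(X) = masshQ P / ZhQ` when `conf t ∈ X ↔ P t`); `updC` (change one listed parameter) with `updC_valid`, **`updC_w`**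
  (`(D.updC i₀ b).w = D.w[edge i₀ ↦ b]`).
* `hubUnder_crMeasure_of_monotone` — what DOES hold: the hub inequality for every positive non-decreasing log-convex `h` (positive
  association, `crMeasure_fkg`).
* `not_hubUnder_count_succ` — the HUB inequality (ALR (15)-shape) fails too for `h(k) = k+1`: path `0–3–2–1` (`7/8, 7/8, 2/3`), hub `2`:
  `μ(0↔2)μ(1↔2) = (343/496)(18/31) > 49/124 = μ(0↔2↔1)`.
* WITNESS `CountCex.tr`: vertices `Fin 5`, pairs `02 (2/3), 03 (2/3), 04 (5/6), 13 (1/2)` (a spanning tree) and the switched pair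
  `f = 01`; `h(k) = k + 1` (positive, increasing, log-concave).  Exact values: `μ_{w[f↦0],h}(0 ↔ 2) = 3/5 > 7/12 = μ_{w[f↦1],h}(0 ↔ 2)`
  (`Z₀ = 10/3`, mass `2`; `Z₁ = 8/3`, mass `14/9`).  Hence **`not_clusterDomAdjCountOn_succ : ¬ ClusterDomAdjCountOn (Fin 5) (k ↦ k+1)`**:
  for a log-concave count weight, opening a pair AT `x` can DECREASE a connection probability from `x` — the likelihood ratio
  `h(k−1)/h(k) = k/(k+1)` between the contracted and deleted worlds INCREASES with `k`, favouring more clusters.  Companion of the node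
  `ClusterDomAdjLogConvexPos` (MM for every log-convex `h`; census 0 violations) and of `clusterDomAdjCountOn_of_monotone` (MM proved for
  non-decreasing log-convex `h`): log-convexity, not monotonicity, is the operative hypothesis.
[cite: Grimmett2006, §1.4 eq. (1.20) (p. 15); Thm. (3.21) (p. 43); §3.9 (pp. 63–65)]
-/

namespace Summit.CriticalPhenomena.PercolationContinuityZ3.Theorems

namespace FK

open MeasureTheory Literature.Probability.LatticeModels Literature.Probability.Percolation
open Literature.Probability.Percolation.BHK2006 (weight)
open Literature.Probability.Percolation.DecisionTree (ind ind_of_mem ind_of_not_mem)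

namespace RCEval

variable (D : RCEval)

/-! ### Computable count-reweighted masses -/

/-- The count-reweighted weight `wQ t · h(kB t)` (computable). [cite: Grimmett2006, §1.4 eq. (1.20) (p. 15)] -/
def mhQ (hQ : ℕ → ℚ) (t : Finset (Fin D.m)) : ℚ := D.wQ t * hQ (D.kB t)

/-- Its total `Σ_t mhQ t` (computable). [cite: Grimmett2006, §1.4 eq. (1.20) (p. 15)] -/
def ZhQ (hQ : ℕ → ℚ) : ℚ := ∑ t : Finset (Fin D.m), D.mhQ hQ t

/-- The unnormalised count-reweighted mass of a computable event. [cite: Grimmett2006, §1.4 eq. (1.20) (p. 15)] -/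
def masshQ (hQ : ℕ → ℚ) (P : Finset (Fin D.m) → Bool) : ℚ := ∑ t : Finset (Fin D.m), if P t then D.mhQ hQ t else 0

/-- Changing the parameter of one listed pair (reducible, so that `(D.updC i₀ b).n` computes). [folklore] -/
abbrev updC (i₀ : Fin D.m) (b : ℚ) : RCEval := ⟨D.n, D.m, D.src, D.dst, Function.update D.c i₀ b, D.q⟩

noncomputable section

open scoped Classical

variable {D}

/-- A configuration using an unlisted pair has product weight `0`. [folklore] -/
theorem weight_eq_zero_of_not_subset {ω : BondConfig (Fin D.n)} (hω : ¬ ω ⊆ Set.range D.edge) :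
    weight (fun e => (D.w e : ℝ)) ω = 0 := by
  obtain ⟨e, heω, he⟩ := Set.not_subset.1 hω
  unfold weight
  exact Finset.prod_eq_zero (Finset.mem_univ e) (by dsimp only; rw [if_pos heω, w_eq_zero_of_notMem_range he])

/-- **The count-reweighted weight of `conf t` is `mhQ t`.** [cite: Grimmett2006, §1.4 eq. (1.20) (p. 15)] -/
theorem crWeight_conf (hD : D.Valid) (hQ : ℕ → ℚ) {h : ℕ → ℝ} (hh : ∀ k, h k = (hQ k : ℝ)) (t : Finset (Fin D.m)) :
    crWeight D.w h (D.conf t) = (D.mhQ hQ t : ℝ) := by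
  unfold crWeight mhQ
  rw [weight_conf hD t, clusterCount_conf t, hh]
  push_cast
  rfl

/-- **Transfer**: `Σ_ω crWeight(ω)·f(ω) = Σ_t mhQ t · f(conf t)`. [cite: Grimmett2006, §1.4 eq. (1.20) (p. 15)] -/
theorem sum_crWeight_mul (hD : D.Valid) (hQ : ℕ → ℚ) {h : ℕ → ℝ} (hh : ∀ k, h k = (hQ k : ℝ)) (f : BondConfig (Fin D.n) → ℝ) :
    ∑ ω : BondConfig (Fin D.n), crWeight D.w h ω * f ω = ∑ t : Finset (Fin D.m), (D.mhQ hQ t : ℝ) * f (D.conf t) := by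
  have hsub : Finset.univ.image D.conf ⊆ (Finset.univ : Finset (BondConfig (Fin D.n))) := Finset.subset_univ _
  rw [← Finset.sum_subset hsub]
  · rw [Finset.sum_image fun s _ t _ h => conf_injective hD h]
    exact Finset.sum_congr rfl fun t _ => by rw [crWeight_conf hD hQ hh t]
  · intro ω _ hω
    have hω' : ¬ ω ⊆ Set.range D.edge := by
      intro h'
      obtain ⟨t, rfl⟩ := exists_conf_eq_of_subset h'
      exact hω (Finset.mem_image.2 ⟨t, Finset.mem_univ _, rfl⟩)
    unfold crWeight
    rw [weight_eq_zero_of_not_subset hω', zero_mul, zero_mul]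

/-- **The normalising constant is `ZhQ`.** [cite: Grimmett2006, §1.4 eq. (1.20) (p. 15)] -/
theorem crPartition_eq_ZhQ (hD : D.Valid) (hQ : ℕ → ℚ) {h : ℕ → ℝ} (hh : ∀ k, h k = (hQ k : ℝ)) :
    crPartition D.w h = (D.ZhQ hQ : ℝ) := by
  unfold crPartition ZhQ
  have h1 := sum_crWeight_mul hD hQ hh (fun _ => 1)
  simp only [mul_one] at h1
  rw [h1, Rat.cast_sum]

/-- **The measure of a computable event**: `μ_{w,h}(X) = masshQ P / ZhQ` (`h > 0`). [cite: Grimmett2006, §1.4 eq. (1.20) (p. 15)] -/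
theorem cr_real_eq_masshQ_div (hD : D.Valid) {hQ : ℕ → ℚ} {h : ℕ → ℝ} (hh : ∀ k, h k = (hQ k : ℝ)) (hpos : ∀ k, 0 < h k)
    {X : Set (BondConfig (Fin D.n))} {P : Finset (Fin D.m) → Bool} (hP : ∀ t, D.conf t ∈ X ↔ P t = true) :
    (crMeasure D.w h).real X = ((D.masshQ hQ P / D.ZhQ hQ : ℚ) : ℝ) := by
  rw [crMeasure_real_eq_sum_div D.w hpos X, sum_crWeight_mul hD hQ hh, crPartition_eq_ZhQ hD hQ hh]
  push_cast
  congr 1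
  unfold masshQ
  push_cast
  refine Finset.sum_congr rfl fun t _ => ?_
  by_cases ht : P t = true
  · rw [if_pos ht, ind_of_mem ((hP t).2 ht), mul_one]
  · rw [if_neg ht, ind_of_not_mem (fun hX => ht ((hP t).1 hX)), mul_zero, Rat.cast_zero]

/-! ### Changing one listed parameter -/

/-- The updated data are valid for `b ∈ [0,1]`. [folklore] -/
theorem updC_valid (hD : D.Valid) (i₀ : Fin D.m) {b : ℚ} (hb0 : 0 ≤ b) (hb1 : b ≤ 1) : (D.updC i₀ b).Valid := by
  refine ⟨hD.1, fun (i : Fin D.m) => ?_, hD.2.2⟩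
  show 0 ≤ Function.update D.c i₀ b i ∧ Function.update D.c i₀ b i ≤ 1
  by_cases hi : i = i₀
  · rw [hi, Function.update_self]; exact ⟨hb0, hb1⟩
  · rw [Function.update_of_ne hi]; exact hD.2.1 i

/-- **Updating the listed parameter `i₀` updates the weight vector at `edge i₀`.** [folklore] -/
theorem updC_w (hD : D.Valid) (i₀ : Fin D.m) {b : ℚ} (hb0 : 0 ≤ b) (hb1 : b ≤ 1) :
    (D.updC i₀ b).w = Function.update D.w (D.edge i₀)
      (⟨(b : ℝ), Set.mem_Icc.2 ⟨by exact_mod_cast hb0, by exact_mod_cast hb1⟩⟩ : unitInterval) := by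
  have hD' := updC_valid hD i₀ hb0 hb1
  funext (e : Sym2 (Fin D.n))
  apply Subtype.ext
  by_cases he : e = D.edge i₀
  · subst he
    rw [Function.update_self]
    change (((D.updC i₀ b).w ((D.updC i₀ b).edge i₀) : unitInterval) : ℝ) = (b : ℝ)
    rw [w_edge hD' i₀]
    change ((Function.update D.c i₀ b i₀ : ℚ) : ℝ) = (b : ℝ)
    rw [Function.update_self]
  · rw [Function.update_of_ne he]
    by_cases hr : e ∈ Set.range D.edge
    · obtain ⟨j, rfl⟩ := hr
      have hj : j ≠ i₀ := fun h => he (h ▸ rfl)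
      change (((D.updC i₀ b).w ((D.updC i₀ b).edge j) : unitInterval) : ℝ) = ((D.w (D.edge j) : unitInterval) : ℝ)
      rw [w_edge hD' j, w_edge hD j]
      change ((Function.update D.c i₀ b j : ℚ) : ℝ) = (D.c j : ℝ)
      rw [Function.update_of_ne hj]
    · have hr' : e ∉ Set.range (D.updC i₀ b).edge := hr
      change (((D.updC i₀ b).w e : unitInterval) : ℝ) = ((D.w e : unitInterval) : ℝ)
      rw [w_eq_zero_of_notMem_range hr', w_eq_zero_of_notMem_range hr]

end

end RCEval

/-! ### What DOES hold: the hub inequality for non-decreasing log-convex count weights -/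

section Positive

variable {V : Type*} [Fintype V]

/-- **Hub inequality for `μ_{w,h}`, `h` positive non-decreasing log-convex** (the class `𝓗↑ ⊇ {q^k : q ≥ 1}`): the two connections to a
common vertex are positively correlated — positive association (`crMeasure_fkg`) of the increasing events `{o ↔ a}`, `{b ↔ a}`.  (For
log-convex but DEcreasing `h`, e.g. `q < 1`, this is the open `HubFKPos`-type statement; for log-CONCAVE `h` it is false, below.)
[cite: Grimmett2006, Thm. (3.8) (p. 39)] [cite: AyyerLinussonRavichandran2025, §7 eq. (15) (p. 22)] -/
theorem hubUnder_crMeasure_of_monotone (w : Sym2 V → unitInterval) {h : ℕ → ℝ} (hpos : ∀ k, 0 < h k) (hmono : Monotone h)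
    (hlc : ∀ j, h (j + 1) * h (j + 1) ≤ h j * h (j + 2)) (o a b : V) : HubUnder (crMeasure w h) o a b := by
  unfold HubUnder
  haveI := isProbabilityMeasure_crMeasure w hpos
  rw [probReal_univ, one_mul, KNPreFKG.openConn_symm o a, KNPreFKG.openConn_symm b a, ← clusterIn_mem_eq_openConn a o,
    ← clusterIn_mem_eq_openConn a b]
  exact crMeasure_fkg w hpos hmono hlc (isUpperSet_clusterIn a (SoloBlindKN.isUpperSet_containing o))
    (isUpperSet_clusterIn a (SoloBlindKN.isUpperSet_containing b))

end Positive

/-! ### The witness -/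

noncomputable section

open scoped Classical

namespace CountCex

/-- The listed weighted tree on `Fin 5`: pairs `02 (2/3), 03 (2/3), 04 (5/6), 13 (1/2)` and the switched pair `01` with parameter `0`;
`q = 1` is a dummy (unused by the count reweighting). [cite: Grimmett2006, §1.4 eq. (1.20) (p. 15)] -/
abbrev tr : RCEval := ⟨5, 5, ![0, 0, 0, 1, 0], ![2, 3, 4, 3, 1], ![2 / 3, 2 / 3, 5 / 6, 1 / 2, 0], 1⟩

/-- The same data with the switched pair `01` at parameter `1`. [cite: Grimmett2006, §1.4 eq. (1.20) (p. 15)] -/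
abbrev tr1 : RCEval := tr.updC 4 1

/-- The count weight `h(k) = k + 1` (rational side). [folklore] -/
def hQ (k : ℕ) : ℚ := k + 1

/-- The data are valid. [folklore] -/
theorem tr_valid : tr.Valid := by decide +kernel

/-- Computable predicate of `{0 ↔ 2}`. [folklore] -/
def pC (t : Finset (Fin 5)) : Bool := tr.reachB t 0 2

/-- Computable predicate of `{0 ↔ 2}` for the contracted data (same listed pairs). [folklore] -/
def pC1 (t : Finset (Fin 5)) : Bool := tr1.reachB t 0 2

/-- World `f ↦ 0`: `Z = 10/3`. [cite: Grimmett2006, §1.4 eq. (1.20) (p. 15)] -/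
theorem z0_val : tr.ZhQ hQ = 10 / 3 := by decide +kernel

/-- World `f ↦ 0`: mass of `{0 ↔ 2}` is `2` (probability `3/5`). [cite: Grimmett2006, §1.4 eq. (1.20) (p. 15)] -/
theorem m0_val : tr.masshQ hQ pC = 2 := by decide +kernel

/-- World `f ↦ 1`: `Z = 8/3`. [cite: Grimmett2006, §1.4 eq. (1.20) (p. 15)] -/
theorem z1_val : tr1.ZhQ hQ = 8 / 3 := by decide +kernel

/-- World `f ↦ 1`: mass of `{0 ↔ 2}` is `14/9` (probability `7/12`). [cite: Grimmett2006, §1.4 eq. (1.20) (p. 15)] -/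
theorem m1_val : tr1.masshQ hQ pC1 = 14 / 9 := by decide +kernel

/-- `h(k) = k + 1` as reals vs rationals. [folklore] -/
theorem h_eq (k : ℕ) : ((k : ℝ) + 1) = ((hQ k : ℚ) : ℝ) := by unfold hQ; push_cast; ring

/-- The switched pair `01` is the listed pair of index `4`, at parameter `0`: `w[f↦0] = w`. [folklore] -/
theorem update_zero_eq : Function.update tr.w s(0, 1) 0 = tr.w := by
  rw [Function.update_eq_self_iff]
  apply Subtype.ext
  have h := RCEval.w_edge tr_valid 4
  change ((tr.w s(0, 1) : unitInterval) : ℝ) = ((![2 / 3, 2 / 3, 5 / 6, 1 / 2, 0] : Fin 5 → ℚ) 4 : ℝ) at h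
  change ((0 : unitInterval) : ℝ) = ((tr.w s(0, 1) : unitInterval) : ℝ)
  rw [h]
  simp

/-- `w[f↦1]` is the weight vector of `tr1`. [folklore] -/
theorem update_one_eq : Function.update tr.w s(0, 1) 1 = tr1.w := by
  have h := RCEval.updC_w tr_valid 4 (b := 1) (by norm_num) (by norm_num)
  change tr1.w = Function.update tr.w s(0, 1) _ at h
  rw [h]
  congr 1
  apply Subtype.ext
  simp

/-- **Log-convexity cannot be dropped from the count-weight MM**: for `h(k) = k + 1` (positive, increasing, log-CONCAVE) on the
five-vertex tree above, `μ_{w[f↦0],h}(0 ↔ 2) = 3/5 > 7/12 = μ_{w[f↦1],h}(0 ↔ 2)` — opening the pair `f = 01` at `0` LOWERS the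
probability of `0 ↔ 2`.  So `ClusterDomAdjCountOn (Fin 5) (k ↦ k+1)` is false (refutes the monotone-but-not-log-convex extension of
`ClusterDomAdjLogConvexPos`; exact census: every non-log-convex `h` tested fails, every log-convex one passes).
[cite: Grimmett2006, §1.4 eq. (1.20) (p. 15); §3.9 (pp. 63–65)] -/
theorem not_clusterDomAdjCountOn_succ : ¬ ClusterDomAdjCountOn (Fin 5) (fun k => (k : ℝ) + 1) := by
  intro hMM
  have key := hMM tr.w 0 1 {S | (2 : Fin 5) ∈ S} (SoloBlindKN.isUpperSet_containing 2)
  rw [clusterIn_mem_eq_openConn] at key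
  -- move to the listed data (the `DecidableEq` instances inside `Function.update` differ; `convert` reconciles them)
  have key' : (crMeasure tr.w (fun k => (k : ℝ) + 1)).real (openConn (0 : Fin 5) 2) ≤
      (crMeasure tr1.w (fun k => (k : ℝ) + 1)).real (openConn (0 : Fin 5) 2) := by
    rw [← update_zero_eq, ← update_one_eq]
    convert key using 4
  clear key
  have key := key'
  have hpos : ∀ k : ℕ, (0 : ℝ) < (k : ℝ) + 1 := fun k => by positivity
  have hP0 : ∀ t, tr.conf t ∈ (openConn (0 : Fin 5) 2 : Set (BondConfig (Fin 5))) ↔ pC t = true :=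
    fun t => (RCEval.reachB_iff t 0 2).symm
  have hP1 : ∀ t, tr1.conf t ∈ (openConn (0 : Fin 5) 2 : Set (BondConfig (Fin 5))) ↔ pC1 t = true :=
    fun t => (RCEval.reachB_iff t 0 2).symm
  rw [RCEval.cr_real_eq_masshQ_div tr_valid h_eq hpos hP0,
    RCEval.cr_real_eq_masshQ_div (RCEval.updC_valid tr_valid 4 (by norm_num) (by norm_num)) h_eq hpos hP1,
    m0_val, z0_val, m1_val, z1_val] at key
  norm_num at key

/-! ### The hub inequality also fails for a log-concave count weight -/

/-- The listed weighted path `0 – 3 – 2 – 1` on `Fin 4`: pairs `03 (7/8), 32 (7/8), 12 (2/3)`; `q = 1` dummy.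
[cite: Grimmett2006, §1.4 eq. (1.20) (p. 15)] -/
abbrev path4 : RCEval := ⟨4, 3, ![0, 3, 1], ![3, 2, 2], ![7 / 8, 7 / 8, 2 / 3], 1⟩

/-- The path data are valid. [folklore] -/
theorem path4_valid : path4.Valid := by decide +kernel

/-- Computable predicates of `{0 ↔ 2}`, `{1 ↔ 2}`. [folklore] -/
def pO (t : Finset (Fin 3)) : Bool := path4.reachB t 0 2
/-- Computable predicate of `{1 ↔ 2}`. [folklore] -/
def pB (t : Finset (Fin 3)) : Bool := path4.reachB t 1 2

/-- `Z = 31/12`. [cite: Grimmett2006, §1.4 eq. (1.20) (p. 15)] -/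
theorem pz_val : path4.ZhQ hQ = 31 / 12 := by decide +kernel
/-- Total mass as an event mass. [folklore] -/
theorem pu_val : path4.masshQ hQ (fun _ => true) = 31 / 12 := by decide +kernel
/-- Mass of `{0 ↔ 2}`: `343/192`. [cite: Grimmett2006, §1.4 eq. (1.20) (p. 15)] -/
theorem po_val : path4.masshQ hQ pO = 343 / 192 := by decide +kernel
/-- Mass of `{1 ↔ 2}`: `3/2`. [cite: Grimmett2006, §1.4 eq. (1.20) (p. 15)] -/
theorem pb_val : path4.masshQ hQ pB = 3 / 2 := by decide +kernel
/-- Mass of `{0 ↔ 2 ↔ 1}`: `49/48`. [cite: Grimmett2006, §1.4 eq. (1.20) (p. 15)] -/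
theorem pob_val : path4.masshQ hQ (fun t => pO t && pB t) = 49 / 48 := by decide +kernel

/-- **The hub inequality (ALR (15)-shape) FAILS for the log-concave count weight `h(k) = k + 1`** on the path `0–3–2–1` with hub `2`:
`μ(0 ↔ 2)μ(1 ↔ 2) = (343/496)(18/31) > 49/124 = μ(0 ↔ 2 ↔ 1)` — the cluster-count analogue of fk-1 g7's `HubFKPos` is false
without log-convexity (the census finds it clean for every log-convex `h`, as the `|A| = 1` case of (AG-loc)).
[cite: AyyerLinussonRavichandran2025, §7 eq. (15) (p. 22)] [cite: Grimmett2006, §3.9 (pp. 63–65)] -/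
theorem not_hubUnder_count_succ : ¬ HubUnder (crMeasure path4.w (fun k => (k : ℝ) + 1)) 0 2 1 := by
  intro h
  unfold HubUnder at h
  have hpos : ∀ k : ℕ, (0 : ℝ) < (k : ℝ) + 1 := fun k => by positivity
  have hPO : ∀ t, path4.conf t ∈ (openConn (0 : Fin 4) 2 : Set (BondConfig (Fin 4))) ↔ pO t = true :=
    fun t => (RCEval.reachB_iff t 0 2).symm
  have hPB : ∀ t, path4.conf t ∈ (openConn (1 : Fin 4) 2 : Set (BondConfig (Fin 4))) ↔ pB t = true :=
    fun t => (RCEval.reachB_iff t 1 2).symm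
  have hPU : ∀ t, path4.conf t ∈ (Set.univ : Set (BondConfig (Fin 4))) ↔ (fun _ : Finset (Fin 3) => true) t = true :=
    fun t => by simp
  have hPOB : ∀ t, path4.conf t ∈ (openConn (0 : Fin 4) 2 ∩ openConn (1 : Fin 4) 2 : Set (BondConfig (Fin 4))) ↔
      (fun t => pO t && pB t) t = true := fun t => by
    rw [Set.mem_inter_iff, hPO t, hPB t, Bool.and_eq_true]
  rw [RCEval.cr_real_eq_masshQ_div path4_valid h_eq hpos hPO, RCEval.cr_real_eq_masshQ_div path4_valid h_eq hpos hPB,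
    RCEval.cr_real_eq_masshQ_div path4_valid h_eq hpos hPU, RCEval.cr_real_eq_masshQ_div path4_valid h_eq hpos hPOB,
    po_val, pb_val, pu_val, pob_val, pz_val] at h
  norm_num at h

end CountCex

end

end FK

end Summit.CriticalPhenomena.PercolationContinuityZ3.Theorems
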